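import Literature.MathematicalPhysics.QuantumLattice.PairSourcedTorusTrialStateLimit
import Literature.MathematicalPhysics.QuantumLattice.TorusLimitParity
import HarnessLib

/-!
# Parity-definite torus trial families of the pair-sourced `t–t'` Hubbard tori produce EVEN
# translation-invariant states (the «tiled-trial-state TI bridge» with the evenness slot)

Topic `Literature/MathematicalPhysics/QuantumLattice`; namespace
`Literature.MathematicalPhysics.QuantumLattice` (the file path). Companion of
`PairSourcedTorusTrialStateLimit.lean` (trial-vector torus limits carry the limiting density and sourced
mean energy; periodic existence; two-family mixture) and `TorusLimitParity.lean`
(`IsTorusLimitOf.isEven_of_hasParity`: torus limits of PARITY-definite families are even). The tiled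
products of parity-definite open-cluster vectors that realise the pinning-field trial rows are parity- but
not number-definite (`ClusterProductStates.hasParity_prodFamily`); this file threads the parity hypothesis
`∃ p, TwoCluster.HasParity p ψ` through the existence theorems so that the produced infinite-volume states
land in the standard hypothesis class «translation invariant ∧ even ∧ density `n`» of the tree's transport
lemmas (`le_energyDensityTT'_of_forall_isTranslationInvariant`).

* `exists_isTranslationInvariant_isEven_density_eq_meanEnergy_sourced_eq_of_trialStates` (family form, along
  `L_j → ∞`) and `…_of_periodic_trialStates` (per-side existential form on `q ∣ L`, `L ≥ L₀`): parity-definite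
  unit trial vectors with exact rows `(n, e)` produce an EVEN translation-invariant state of density `n` and
  sourced mean energy `e`.
* `InfVolFermionState.exists_isTranslationInvariant_isEven_density_eq_meanEnergy_le'` — the even twin of the
  intermediate-density mixture lemma of `InfVolFermionStateMixture.lean` (`IsEven.mix`).
* `exists_isTranslationInvariant_isEven_density_eq_meanEnergy_sourced_le_of_two_periodic_trialStates` — two
  parity-definite periodic families bracketing `n` + the literal side condition ⇒ an EVEN translation-invariant
  state of density EXACTLY `n` with `e^{src}_h ≤ u`.

Everything is PROVED; no definition, no named fact, zero compute.

## References
* H. Araki, H. Moriya, Rev. Math. Phys. 15 (2003) 93, §4.1 Def. 4.5 (even states).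
  [cite: ArakiMoriya2003, §4.1 Def. 4.5]
* O. Bratteli, D. W. Robinson, *Operator Algebras and Quantum Statistical Mechanics 1* (1987), §4.3.1
  (invariant states; convexity). [cite: BratteliRobinsonI1987, §4.3.1]
-/

noncomputable section

namespace Literature.MathematicalPhysics.QuantumLattice

open Matrix Finset HubbardWave0 _root_.Filter Literature.Probability.LatticeModels
open scoped _root_.Topology ComplexOrder

section Even

/-- The sides `q·(j + L₀ + 1)` are nonzero for `q ≠ 0`. [folklore] -/
private theorem neZero_mul_succ' {q : ℕ} (hq : 0 < q) (L₀ j : ℕ) : NeZero (q * (j + L₀ + 1)) :=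
  ⟨Nat.mul_ne_zero hq.ne' (Nat.succ_ne_zero _)⟩

/-- The sides `q·(j + L₀ + 1)` diverge. [folklore] -/
private theorem tendsto_mul_succ' {q : ℕ} (hq : 0 < q) (L₀ : ℕ) :
    Tendsto (fun j : ℕ => q * (j + L₀ + 1)) atTop atTop := by
  refine tendsto_atTop_mono (fun j => ?_) tendsto_id
  calc id j = j := rfl
    _ ≤ j + L₀ + 1 := by omega
    _ = 1 * (j + L₀ + 1) := (one_mul _).symm
    _ ≤ q * (j + L₀ + 1) := Nat.mul_le_mul_right _ hq

/-- **One trial family of parity-definite unit vectors, exact rows ⇒ an EVEN translation-invariant state.**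
As `exists_isTranslationInvariant_density_eq_meanEnergy_sourced_eq_of_trialStates`, with each `ψ_{L_j}` of
definite fermion parity (tiled products of parity-definite cluster vectors): the produced torus limit is
moreover even (`IsTorusLimitOf.isEven_of_hasParity`). [cite: ArakiMoriya2003, §4.1 Def. 4.5] -/
theorem exists_isTranslationInvariant_isEven_density_eq_meanEnergy_sourced_eq_of_trialStates (tp U μ h : ℝ)
    {Ls : ℕ → ℕ} [hL0 : ∀ j, NeZero (Ls j)] (hLs : Tendsto Ls atTop atTop)
    (ψ : ∀ L, Fock (Orb (FermionTorus 2 L))) {p : ℕ → ℕ} (hpar : ∀ j, TwoCluster.HasParity (p j) (ψ (Ls j)))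
    (hψ1 : ∀ j, star (ψ (Ls j)) ⬝ᵥ ψ (Ls j) = 1) {n e : ℝ}
    (hn : ∀ j, (expect totalNumber (ψ (Ls j))).re = n * (Ls j : ℝ) ^ 2)
    (he : ∀ j, (expect (dWaveSourceTorusTT' (Ls j) tp U μ h) (ψ (Ls j))).re = e * (Ls j : ℝ) ^ 2) :
    ∃ σ : InfVolFermionState 2, (∃ φ : ℕ → ℕ, StrictMono φ ∧ σ.IsTorusLimitOf ψ (Ls ∘ φ)) ∧
      σ.IsTranslationInvariant ∧ σ.IsEven ∧ σ.density = n ∧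
      σ.meanEnergy (hubbardTTPrimeSourcedInteraction 1 tp U μ dWaveFormFactor h) 1 = e := by
  obtain ⟨σ, ⟨φ, hφ, hσ⟩, hTI, hρ, hE⟩ :=
    exists_isTranslationInvariant_density_eq_meanEnergy_sourced_eq_of_trialStates tp U μ h hLs ψ hψ1 hn he
  have hσ' : σ.IsTorusLimitOf ψ (fun j => Ls (φ j)) := hσ
  exact ⟨σ, ⟨φ, hφ, hσ⟩, hTI, hσ'.isEven_of_hasParity (p := fun j => p (φ j)) fun j => hpar (φ j), hρ, hE⟩

/-- **Per-side existential form on a sub-progression, parity-definite trial vectors ⇒ an EVEN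
translation-invariant state** of density `n` and sourced mean energy `e`. [cite: ArakiMoriya2003, §4.1 Def. 4.5] -/
theorem exists_isTranslationInvariant_isEven_density_eq_meanEnergy_sourced_eq_of_periodic_trialStates
    (tp U μ h : ℝ) {q : ℕ} (hq : 0 < q) (L₀ : ℕ) {n e : ℝ}
    (hrows : ∀ L : ℕ, q ∣ L → L₀ ≤ L → ∀ [NeZero L], ∃ ψ : Fock (Orb (FermionTorus 2 L)),
      (∃ p : ℕ, TwoCluster.HasParity p ψ) ∧ star ψ ⬝ᵥ ψ = 1 ∧ (expect totalNumber ψ).re = n * (L : ℝ) ^ 2 ∧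
        (expect (dWaveSourceTorusTT' L tp U μ h) ψ).re = e * (L : ℝ) ^ 2) :
    ∃ σ : InfVolFermionState 2, σ.IsTranslationInvariant ∧ σ.IsEven ∧ σ.density = n ∧
      σ.meanEnergy (hubbardTTPrimeSourcedInteraction 1 tp U μ dWaveFormFactor h) 1 = e := by
  classical
  have hex : ∀ L : ℕ, ∃ ψ : Fock (Orb (FermionTorus 2 L)), ∀ (hqL : q ∣ L) (hL : L₀ ≤ L) (hL0 : L ≠ 0),
      (∃ p : ℕ, TwoCluster.HasParity p ψ) ∧ star ψ ⬝ᵥ ψ = 1 ∧ (expect totalNumber ψ).re = n * (L : ℝ) ^ 2 ∧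
        (expect (@dWaveSourceTorusTT' L ⟨hL0⟩ tp U μ h) ψ).re = e * (L : ℝ) ^ 2 := by
    intro L
    by_cases hc : q ∣ L ∧ L₀ ≤ L ∧ L ≠ 0
    · obtain ⟨ψ, hψ⟩ := @hrows L hc.1 hc.2.1 ⟨hc.2.2⟩
      exact ⟨ψ, fun _ _ _ => hψ⟩
    · refine ⟨0, fun hqL hL hL0 => absurd ⟨hqL, hL, hL0⟩ hc⟩
  choose ψ hψ using hex
  set Ls : ℕ → ℕ := fun j => q * (j + L₀ + 1) with hLs_def
  haveI hL0 : ∀ j, NeZero (Ls j) := fun j => neZero_mul_succ' hq L₀ j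
  have hadm : ∀ j, q ∣ Ls j ∧ L₀ ≤ Ls j := fun j =>
    ⟨Dvd.intro _ rfl, by
      calc L₀ ≤ j + L₀ + 1 := by omega
        _ = 1 * (j + L₀ + 1) := (one_mul _).symm
        _ ≤ q * (j + L₀ + 1) := Nat.mul_le_mul_right _ hq⟩
  have hrow : ∀ j, (∃ p : ℕ, TwoCluster.HasParity p (ψ (Ls j))) ∧ star (ψ (Ls j)) ⬝ᵥ ψ (Ls j) = 1 ∧
      (expect totalNumber (ψ (Ls j))).re = n * (Ls j : ℝ) ^ 2 ∧
      (expect (dWaveSourceTorusTT' (Ls j) tp U μ h) (ψ (Ls j))).re = e * (Ls j : ℝ) ^ 2 :=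
    fun j => hψ (Ls j) (hadm j).1 (hadm j).2 (hL0 j).ne
  choose p hp using fun j => (hrow j).1
  obtain ⟨σ, -, hσ, hev, hρ, hE⟩ :=
    exists_isTranslationInvariant_isEven_density_eq_meanEnergy_sourced_eq_of_trialStates tp U μ h
      (tendsto_mul_succ' hq L₀) ψ hp (fun j => (hrow j).2.1) (fun j => (hrow j).2.2.1) (fun j => (hrow j).2.2.2)
  exact ⟨σ, hσ, hev, hρ, hE⟩

/-- **Intermediate densities by mixing EVEN states** (the even twin of
`InfVolFermionState.exists_isTranslationInvariant_density_eq_meanEnergy_le'`): translation-invariant even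
`ω₁, ω₂` with densities `n₁ < n₂` bracketing `n`, caps `e_Ψ(ωᵢ) ≤ eᵢ` and
`(n₂ − n)·e₁ + (n − n₁)·e₂ ≤ u·(n₂ − n₁)` give a translation-invariant EVEN state of density `n` with `e_Ψ ≤ u`
(`IsTranslationInvariant.mix`, `IsEven.mix`, `density_mix`, `meanEnergy_mix`). [cite: BratteliRobinsonI1987, §4.3.1] -/
theorem InfVolFermionState.exists_isTranslationInvariant_isEven_density_eq_meanEnergy_le' {d : ℕ}
    {ω₁ ω₂ : InfVolFermionState d} (h₁ : ω₁.IsTranslationInvariant) (h₂ : ω₂.IsTranslationInvariant)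
    (he₁' : ω₁.IsEven) (he₂' : ω₂.IsEven) {n₁ n₂ n e₁ e₂ u : ℝ}
    (hn₁ : ω₁.density = n₁) (hn₂ : ω₂.density = n₂) (hlt : n₁ < n₂) (hle₁ : n₁ ≤ n) (hle₂ : n ≤ n₂)
    (Ψ : FermionInteraction d) (R : ℝ) (he₁ : ω₁.meanEnergy Ψ R ≤ e₁) (he₂ : ω₂.meanEnergy Ψ R ≤ e₂)
    (hu : (n₂ - n) * e₁ + (n - n₁) * e₂ ≤ u * (n₂ - n₁)) :
    ∃ σ : InfVolFermionState d, σ.IsTranslationInvariant ∧ σ.IsEven ∧ σ.density = n ∧ σ.meanEnergy Ψ R ≤ u := by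
  have hd : 0 < n₂ - n₁ := sub_pos.2 hlt
  have hw₀ : 0 ≤ (n₂ - n) / (n₂ - n₁) := div_nonneg (sub_nonneg.2 hle₂) hd.le
  have hw₁ : (n₂ - n) / (n₂ - n₁) ≤ 1 := by
    rw [div_le_one hd]
    linarith
  have hw₁' : 0 ≤ 1 - (n₂ - n) / (n₂ - n₁) := sub_nonneg.2 hw₁
  refine ⟨InfVolFermionState.mix _ hw₀ hw₁ ω₁ ω₂, h₁.mix h₂ _ hw₀ hw₁, he₁'.mix he₂' _ hw₀ hw₁, ?_, ?_⟩
  · rw [InfVolFermionState.density_mix, hn₁, hn₂]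
    field_simp
    ring
  · rw [InfVolFermionState.meanEnergy_mix]
    have hone : 1 - (n₂ - n) / (n₂ - n₁) = (n - n₁) / (n₂ - n₁) := by
      field_simp
      ring
    calc (n₂ - n) / (n₂ - n₁) * ω₁.meanEnergy Ψ R + (1 - (n₂ - n) / (n₂ - n₁)) * ω₂.meanEnergy Ψ R
        ≤ (n₂ - n) / (n₂ - n₁) * e₁ + (1 - (n₂ - n) / (n₂ - n₁)) * e₂ :=
          add_le_add (mul_le_mul_of_nonneg_left he₁ hw₀) (mul_le_mul_of_nonneg_left he₂ hw₁')
      _ = ((n₂ - n) * e₁ + (n - n₁) * e₂) / (n₂ - n₁) := by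
          rw [hone]
          field_simp
      _ ≤ u := by
          rw [div_le_iff₀ hd]
          exact hu

/-- **Two parity-definite periodic trial families and the mixture ⇒ an EVEN translation-invariant state of
density EXACTLY `n` with `e^{src}_h ≤ u`** (the `hcap` shape with evenness).
[cite: BratteliRobinsonI1987, §4.3.1] -/
theorem exists_isTranslationInvariant_isEven_density_eq_meanEnergy_sourced_le_of_two_periodic_trialStates
    (tp U μ h : ℝ) {q₁ q₂ : ℕ} (hq₁ : 0 < q₁) (hq₂ : 0 < q₂) (L₁ L₂ : ℕ) {n₁ n₂ n e₁ e₂ u : ℝ}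
    (hrows₁ : ∀ L : ℕ, q₁ ∣ L → L₁ ≤ L → ∀ [NeZero L], ∃ ψ : Fock (Orb (FermionTorus 2 L)),
      (∃ p : ℕ, TwoCluster.HasParity p ψ) ∧ star ψ ⬝ᵥ ψ = 1 ∧ (expect totalNumber ψ).re = n₁ * (L : ℝ) ^ 2 ∧
        (expect (dWaveSourceTorusTT' L tp U μ h) ψ).re = e₁ * (L : ℝ) ^ 2)
    (hrows₂ : ∀ L : ℕ, q₂ ∣ L → L₂ ≤ L → ∀ [NeZero L], ∃ ψ : Fock (Orb (FermionTorus 2 L)),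
      (∃ p : ℕ, TwoCluster.HasParity p ψ) ∧ star ψ ⬝ᵥ ψ = 1 ∧ (expect totalNumber ψ).re = n₂ * (L : ℝ) ^ 2 ∧
        (expect (dWaveSourceTorusTT' L tp U μ h) ψ).re = e₂ * (L : ℝ) ^ 2)
    (hlt : n₁ < n₂) (hle₁ : n₁ ≤ n) (hle₂ : n ≤ n₂) (hu : (n₂ - n) * e₁ + (n - n₁) * e₂ ≤ u * (n₂ - n₁)) :
    ∃ σ : InfVolFermionState 2, σ.IsTranslationInvariant ∧ σ.IsEven ∧ σ.density = n ∧
      σ.meanEnergy (hubbardTTPrimeSourcedInteraction 1 tp U μ dWaveFormFactor h) 1 ≤ u := by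
  obtain ⟨ω₁, hω₁, hev₁, hρ₁, hE₁⟩ :=
    exists_isTranslationInvariant_isEven_density_eq_meanEnergy_sourced_eq_of_periodic_trialStates tp U μ h hq₁ L₁
      hrows₁
  obtain ⟨ω₂, hω₂, hev₂, hρ₂, hE₂⟩ :=
    exists_isTranslationInvariant_isEven_density_eq_meanEnergy_sourced_eq_of_periodic_trialStates tp U μ h hq₂ L₂
      hrows₂
  exact InfVolFermionState.exists_isTranslationInvariant_isEven_density_eq_meanEnergy_le' hω₁ hω₂ hev₁ hev₂ hρ₁ hρ₂
    hlt hle₁ hle₂ _ 1 hE₁.le hE₂.le hu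

end Even

end Literature.MathematicalPhysics.QuantumLattice

end
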